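import Summits.CriticalPhenomena.PercolationContinuityZ3.Theorems.PercNearOneGluingNoHeavyLowerTailCILCutObserverSteinerTools
import HarnessLib

/-!
# `NoHeavyLowerTail` (stmt-CriticalPhenomena-4575) — the cut observer with STEINER ports:
# the T-form (guarded cumulative isolation) transfers through separated branches

Support file (prover `prim-hp-5`, technique "blob-quotient induction"; `--supports
stmt-CriticalPhenomena-4575`).  No definitions, no named facts, no sorries.

Notation: `μ = prodBernoulli w` on `Fin n`, relays `A`, observer `o ∉ A`, level `j`; everything is read
inside a vertex set `W ∋ o` (configurations restricted to the pairs inside `W`), so that the theorem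
composes with itself; `N = |{x ∈ A : o ↔ x}|`, `π(c) = {x ∈ A : c ↔ x}`.
`Theorems.cumulativeIsolation_cutObserver` (prover `prim-gen-induct`) proves `μ{1 ≤ N ≤ j} ≤ μ{|π(a)| ≤ j}`
when `W ∖ o` splits into separated branches `V l` attached to `o` by ONE pair `o–p l` whose port is a RELAY.
Here the ports may be STEINER vertices — the situation of every observer inside a tree-like Steiner hull.
The statement that survives the recursion is not CIL but the T-FORM (guarded CIL)
`T(W, o, c) : μ{1 ≤ N ≤ j} ≤ μ{1 ≤ N ∧ |π(c)| ≤ j}`, which gives `μ{1 ≤ N ≤ j} ≤ μ{1 ≤ N}·μ{|π(c)| ≤ j}`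
by Harris (`{1 ≤ N}` increasing, `{|π(c)| ≤ j}` decreasing), hence CIL.

**Theorem `CutObserver.SteinerPorts.tform_transfer`.**  If every branch `l` carries `a l ∈ V l` such that
either the branch holds no relay, or `a l ∈ A` and the BRANCH T-form `T(V l, p l, a l)` holds (read inside
`V l`; trivial for a relay port, `a l = p l`), and `i` is a live branch maximising
`t_l = μ{|π_{V l}(a l)| ≤ j}`, then `T(W, o, a i)`.  Proof (termwise; Harris is the only correlation
inequality): split along `X_i = {o–p i open}`, `U = {a i ↔ p i inside V i}` and `{M_i = 0}` (`M_l` = relay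
mass of the port's branch cluster).  On `X_i ∩ U` the clusters of `o` and `a i` coincide.  Off `X_i`, and on
`X_i ∩ {M_i = 0}`, the minority event needs an EFFECTIVE attachment elsewhere (`o–p l` open AND `M_l ≥ 1`)
with every effectively attached branch light: probability `∏(1 − c_l + c_l s_l) − ∏(1 − c_l u_l) ≤
t·(1 − ∏(1 − c_l u_l))` (`u_l = μ{M_l ≥ 1}`; telescoping `CutObserver.prod_sub_prod_le` after
`μ{1 ≤ M_l ≤ j} ≤ u_l t_l`, the branch T-form followed by Harris), matched on the right by `{|π_{V i}(a i)| ≤ j}`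
(on `{M_i = 0}`: two decreasing events, Harris) times the same attachment probability; on
`X_i ∩ Uᶜ ∩ {M_i ≥ 1}` it is the two-cluster part of the branch T-form of `V i`.
Whole-graph corollaries (`∃ a ∈ A, …`; all trees by induction on the hull) are in `…CILCutObserverSteinerCIL`.
Numerics (exact DP, lab/trees3.py): 0 violations / 2 369 random trees with Steiner vertices, `n ≤ 9`.
-/

noncomputable section

namespace Summit.CriticalPhenomena.PercolationContinuityZ3.Theorems

open MeasureTheory Set Literature.Probability.LatticeModels Literature.Probability.Percolation
open scoped Classical BigOperators

variable {n : ℕ}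

namespace CutObserver

namespace SteinerPorts

/-! ### The transfer theorem -/

/-- **T-form transfer through a cut observer with Steiner ports.**  Inside `W ∋ o`, let `W ∖ o` be covered
by pairwise disjoint branches `V l` with ports `p l ∈ V l` (relays OR non-relays), the only positive pairs at
`o` inside `W` being the port pairs and no positive pair joining two branches; each branch carries
`a l ∈ V l`, a branch with `a l ∉ A` holds no relay, and a branch with `a l ∈ A` satisfies the branch T-form
`μ{1 ≤ M_l ≤ j} ≤ μ{1 ≤ M_l ∧ |π_{V l}(a l)| ≤ j}`.  If `i` is a live branch maximising `μ{|π_{V l}(a l)| ≤ j}`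
among live branches, then `μ{1 ≤ N ≤ j} ≤ μ{1 ≤ N ∧ |π_W(a i)| ≤ j}` inside `W`. [folklore] -/
theorem tform_transfer (w : Sym2 (Fin n) → unitInterval) (A W : Finset (Fin n)) (o : Fin n) (j : ℕ)
    {d : ℕ} (V : Fin d → Finset (Fin n)) (p a : Fin d → Fin n) (i : Fin d)
    (hoA : o ∉ A) (hpV : ∀ l, p l ∈ V l) (haV : ∀ l, a l ∈ V l) (hoV : ∀ l, o ∉ V l)
    (hdisj : ∀ l l', l ≠ l' → Disjoint (V l) (V l'))
    (hoW : o ∈ W) (hVW : ∀ l, V l ⊆ W) (hcover : ∀ v ∈ W, v ≠ o → ∃ l, v ∈ V l)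
    (hobs : ∀ l, ∀ v ∈ V l, v ≠ p l → w s(o, v) = 0)
    (hsep : ∀ l l', l ≠ l' → ∀ u ∈ V l, ∀ v ∈ V l', w s(u, v) = 0)
    (hdead : ∀ l, a l ∉ A → ∀ x ∈ V l, x ∉ A)
    (hT : ∀ l, a l ∈ A →
      (prodBernoulli w).real {ω : BondConfig (Fin n) |
          1 ≤ (A.filter fun x => (openGraph (ω ∩ ↑((V l).sym2))).Reachable (p l) x).card ∧
            (A.filter fun x => (openGraph (ω ∩ ↑((V l).sym2))).Reachable (p l) x).card ≤ j} ≤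
        (prodBernoulli w).real {ω : BondConfig (Fin n) |
          1 ≤ (A.filter fun x => (openGraph (ω ∩ ↑((V l).sym2))).Reachable (p l) x).card ∧
            (A.filter fun x => (openGraph (ω ∩ ↑((V l).sym2))).Reachable (a l) x).card ≤ j})
    (hi : a i ∈ A)
    (himax : ∀ l, a l ∈ A →
      (prodBernoulli w).real {ω : BondConfig (Fin n) |
          (A.filter fun x => (openGraph (ω ∩ ↑((V l).sym2))).Reachable (a l) x).card ≤ j} ≤
        (prodBernoulli w).real {ω : BondConfig (Fin n) |
          (A.filter fun x => (openGraph (ω ∩ ↑((V i).sym2))).Reachable (a i) x).card ≤ j}) :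
    (prodBernoulli w).real {ω : BondConfig (Fin n) |
        1 ≤ (A.filter fun x => (openGraph (ω ∩ ↑(W.sym2))).Reachable o x).card ∧
          (A.filter fun x => (openGraph (ω ∩ ↑(W.sym2))).Reachable o x).card ≤ j} ≤
      (prodBernoulli w).real {ω : BondConfig (Fin n) |
        1 ≤ (A.filter fun x => (openGraph (ω ∩ ↑(W.sym2))).Reachable o x).card ∧
          (A.filter fun x => (openGraph (ω ∩ ↑(W.sym2))).Reachable (a i) x).card ≤ j} := by
  haveI : IsProbabilityMeasure (prodBernoulli w) := inferInstance
  -- ### notation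
  set M : Fin d → BondConfig (Fin n) → ℕ := fun l ω =>
    (A.filter fun x => (openGraph (ω ∩ ↑((V l).sym2))).Reachable (p l) x).card with hM
  set Lb : Fin d → BondConfig (Fin n) → ℕ := fun l ω =>
    (A.filter fun x => (openGraph (ω ∩ ↑((V l).sym2))).Reachable (a l) x).card with hLb
  set N : BondConfig (Fin n) → ℕ := fun ω =>
    (A.filter fun x => (openGraph (ω ∩ ↑(W.sym2))).Reachable o x).card with hN
  set Lc : BondConfig (Fin n) → ℕ := fun ω =>
    (A.filter fun x => (openGraph (ω ∩ ↑(W.sym2))).Reachable (a i) x).card with hLc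
  set L := {ω : BondConfig (Fin n) | 1 ≤ N ω ∧ N ω ≤ j} with hL
  set R := {ω : BondConfig (Fin n) | 1 ≤ N ω ∧ Lc ω ≤ j} with hR
  change (prodBernoulli w).real L ≤ (prodBernoulli w).real R
  set c : Fin d → ℝ := fun l => (w s(o, p l) : ℝ) with hc
  set sl : Fin d → ℝ := fun l => (prodBernoulli w).real {ω : BondConfig (Fin n) | M l ω ≤ j} with hsl
  set ul : Fin d → ℝ := fun l => (prodBernoulli w).real {ω : BondConfig (Fin n) | 1 ≤ M l ω} with hul
  set t : ℝ := (prodBernoulli w).real {ω : BondConfig (Fin n) | Lb i ω ≤ j} with ht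
  set Xi := {ω : BondConfig (Fin n) | s(o, p i) ∈ ω} with hXi
  set Xc := {ω : BondConfig (Fin n) | s(o, p i) ∉ ω} with hXc
  set U := {ω : BondConfig (Fin n) | (openGraph (ω ∩ ↑((V i).sym2))).Reachable (a i) (p i)} with hU
  set Z := {ω : BondConfig (Fin n) | ¬ 1 ≤ M i ω} with hZ
  set Bt := {ω : BondConfig (Fin n) | Lb i ω ≤ j} with hBt
  set Y : Fin d → Set (BondConfig (Fin n)) := fun l => {ω | s(o, p l) ∈ ω ∧ 1 ≤ M l ω} with hY
  set NF : Fin d → Set (BondConfig (Fin n)) := fun l => {ω | s(o, p l) ∈ ω → M l ω ≤ j} with hNF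
  set G := {ω : BondConfig (Fin n) | ∀ e ∈ ω, w e ≠ 0} with hG
  set T := Finset.univ.erase i with hT'
  set S : Fin d → Finset (Sym2 (Fin n)) := fun l => insert s(o, p l) (V l).sym2 with hS
  -- ### pointwise geometry on the support event
  have hMleN : ∀ ω ∈ G, ∀ l, s(o, p l) ∈ ω → M l ω ≤ N ω := fun ω hω l hl =>
    branchMass_le_obsCount w A W o V p hoA hpV hoV hoW hVW hcover hobs hsep ω hω l hl
  have hNpos : ∀ ω ∈ G, 1 ≤ N ω ↔ ∃ l, s(o, p l) ∈ ω ∧ 1 ≤ M l ω := fun ω hω =>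
    obsCount_pos_iff w A W o V p hoA hpV hoV hoW hVW hcover hobs hsep ω hω
  have hLcLb : ∀ ω ∈ G, ¬ (ω ∈ U ∧ ω ∈ Xi) → Lc ω = Lb i ω := by
    intro ω hω hnot
    simp only [hLc, hLb]
    congr 1
    exact Finset.filter_congr fun x _ =>
      reach_branch_iff w W o V p hVW hcover hobs hsep ω hω i (haV i) hnot x
  have hLcN : ∀ ω, ω ∈ U → ω ∈ Xi → Lc ω = N ω := fun ω hUω hXω =>
    witnessCount_eq_obsCount A W o V p hpV hoV hoW hVW i ω hUω hXω
  have hUM : ∀ ω, ω ∈ U → M i ω = Lb i ω ∧ 1 ≤ M i ω := fun ω hUω =>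
    branchCounts_of_joined A V p i hi ω hUω
  have hZU : ∀ ω, ω ∈ Z → ω ∉ U := fun ω hZω hUω => hZω (hUM ω hUω).2
  have hMdead : ∀ l, a l ∉ A → ∀ ω, M l ω = 0 := by
    intro l hl ω
    refine Finset.card_eq_zero.2 (Finset.filter_eq_empty_iff.2 fun x hx hreach => ?_)
    exact hdead l hl x (mem_of_reachable_restrict (hpV l) hreach) hx
  have hMup : ∀ l, IsUpperSet {ω : BondConfig (Fin n) | 1 ≤ M l ω} := fun l ω ω' hle h =>
    le_trans h (card_filter_reachable_mono A (V l) (p l) hle)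
  have hLblow : ∀ l, IsLowerSet {ω : BondConfig (Fin n) | Lb l ω ≤ j} := fun l ω ω' hle h =>
    le_trans (card_filter_reachable_mono A (V l) (a l) hle) h
  have hZlow : IsLowerSet Z := fun ω ω' hle h h1 =>
    h (le_trans h1 (card_filter_reachable_mono A (V i) (p i) hle))
  -- ### scalars
  have hc0 : ∀ l, 0 ≤ c l := fun l => (w s(o, p l)).2.1; have hc1 : ∀ l, c l ≤ 1 := fun l => (w s(o, p l)).2.2
  have ht0 : 0 ≤ t := measureReal_nonneg; have ht1 : t ≤ 1 := measureReal_le_one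
  have hu0 : ∀ l, 0 ≤ ul l := fun l => measureReal_nonneg; have hu1 : ∀ l, ul l ≤ 1 := fun l => measureReal_le_one
  have hs0 : ∀ l, 0 ≤ sl l := fun l => measureReal_nonneg
  -- `b_l = s_l + u_l - 1 ≤ u_l · t`: branch T-form, Harris, maximality of `i` (dead branches: `b_l = 0`)
  have hbl : ∀ l, sl l + ul l - 1 ≤ ul l * t := by
    intro l
    rw [← measureReal_one_le_and_le w (M l) j]
    by_cases hl : a l ∈ A
    · calc (prodBernoulli w).real {ω : BondConfig (Fin n) | 1 ≤ M l ω ∧ M l ω ≤ j}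
          ≤ (prodBernoulli w).real ({ω : BondConfig (Fin n) | 1 ≤ M l ω} ∩ {ω | Lb l ω ≤ j}) := hT l hl
        _ ≤ (prodBernoulli w).real {ω : BondConfig (Fin n) | 1 ≤ M l ω} *
              (prodBernoulli w).real {ω : BondConfig (Fin n) | Lb l ω ≤ j} :=
            prodBernoulli_harris_upper_lower w (hMup l) (hLblow l) MeasurableSet.of_discrete
              MeasurableSet.of_discrete
        _ ≤ ul l * t := mul_le_mul_of_nonneg_left (himax l hl) (hu0 l)
    · have h0 : {ω : BondConfig (Fin n) | 1 ≤ M l ω ∧ M l ω ≤ j} = ∅ := by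
        ext ω
        simp only [mem_setOf_eq, mem_empty_iff_false, iff_false, not_and]
        intro h1
        have := hMdead l hl ω
        omega
      rw [h0, measureReal_empty]
      exact mul_nonneg (hu0 l) ht0
  -- ### the telescoping bound
  set c' : Fin d → ℝ := fun l => c l * ul l with hc'
  have hc'0 : ∀ l, 0 ≤ c' l := fun l => mul_nonneg (hc0 l) (hu0 l)
  have hc'1 : ∀ l, c' l ≤ 1 := fun l => by
    have := mul_le_mul (hc1 l) (hu1 l) (hu0 l) zero_le_one
    simpa [hc'] using this
  set D : ℝ := 1 - ∏ l ∈ T, (1 - c' l) with hD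
  have hD0 : 0 ≤ D := by
    have : ∏ l ∈ T, (1 - c' l) ≤ 1 :=
      Finset.prod_le_one (fun l _ => by linarith [hc'1 l]) fun l _ => by linarith [hc'0 l]
    linarith
  have htel : ∏ l ∈ T, (1 - c l + c l * sl l) - ∏ l ∈ T, (1 - c' l) ≤ t * D := by
    have hstep : ∏ l ∈ T, (1 - c l + c l * sl l) ≤ ∏ l ∈ T, (1 - c' l + c' l * t) := by
      refine Finset.prod_le_prod (fun l _ => by nlinarith [hc0 l, hc1 l, hs0 l]) fun l _ => ?_
      have h2 : c l * (sl l + ul l - 1) ≤ c l * (ul l * t) := mul_le_mul_of_nonneg_left (hbl l) (hc0 l)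
      simp only [hc']
      nlinarith
    have h := prod_sub_prod_le T c' (fun _ => t) t (fun l _ => hc'0 l) (fun l _ => hc'1 l)
      (fun _ _ => ht0) (fun _ _ => le_rfl) ht1
    rw [hD]
    linarith
  -- ### supports, independence, values
  have hSdisj : (↑T : Set (Fin d)).PairwiseDisjoint S :=
    fun k _ k' _ hkk' => supports_disjoint o V p hpV hoV hdisj hkk'
  have hsub_i : (↑(S i) : Set (Sym2 (Fin n))) ⊆ (⋃ l ∈ T, (↑(S l) : Set (Sym2 (Fin n))))ᶜ := by
    intro e he
    simp only [mem_compl_iff, mem_iUnion, Finset.mem_coe, not_exists]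
    intro l hl hel
    exact Finset.disjoint_left.1 (supports_disjoint o V p hpV hoV hdisj
      (Ne.symm (Finset.mem_erase.1 hl).1)) (Finset.mem_coe.1 he) hel
  have hNF_det : ∀ l ∈ T, DeterminedBy (NF l) (↑(S l) : Set (Sym2 (Fin n))) :=
    fun l _ => determinedBy_noHeavy A (V l) (p l) j s(o, p l)
  have hYc_det : ∀ l ∈ T, DeterminedBy (Y l)ᶜ (↑(S l) : Set (Sym2 (Fin n))) :=
    fun l _ => determinedBy_insert_restrict (V l) s(o, p l)
      (fun P ξ => ¬ (P ∧ 1 ≤ (A.filter fun x => (openGraph ξ).Reachable (p l) x).card))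
  have hYcNF : ∀ l ∈ T, (Y l)ᶜ ⊆ NF l := by
    intro l _ ω hω hopen
    have hω' : ¬ (s(o, p l) ∈ ω ∧ 1 ≤ M l ω) := hω
    have : M l ω = 0 := by
      by_contra h
      exact hω' ⟨hopen, Nat.one_le_iff_ne_zero.2 h⟩
    omega
  have hNFval : ∏ l ∈ T, (prodBernoulli w).real (NF l) = ∏ l ∈ T, (1 - c l + c l * sl l) :=
    Finset.prod_congr rfl fun l _ =>
      measureReal_noHeavy w A (V l) (p l) j s(o, p l) (portEdge_not_mem_sym2 o V p hoV l)
  have hYcval : ∏ l ∈ T, (prodBernoulli w).real (Y l)ᶜ = ∏ l ∈ T, (1 - c' l) := by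
    refine Finset.prod_congr rfl fun l _ => ?_
    have hYeq : Y l = {ω : BondConfig (Fin n) | s(o, p l) ∈ ω} ∩
        {ω | 1 ≤ (A.filter fun x => (openGraph (ω ∩ ↑((V l).sym2))).Reachable (p l) x).card} :=
      Set.ext fun ω => Iff.rfl
    rw [measureReal_compl MeasurableSet.of_discrete, probReal_univ, hYeq,
      measureReal_open_inter_restrict w (V l) s(o, p l) (portEdge_not_mem_sym2 o V p hoV l)
        (fun ξ => 1 ≤ (A.filter fun x => (openGraph ξ).Reachable (p l) x).card)]
  -- ### the generic piece: an event `E` inside which the port's own branch contributes nothing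
  have hpiece : ∀ E EB : Set (BondConfig (Fin n)),
      DeterminedBy E (↑(S i) : Set (Sym2 (Fin n))) → DeterminedBy EB (↑(S i) : Set (Sym2 (Fin n))) →
      EB ⊆ E ∩ Bt → (∀ ω ∈ E, s(o, p i) ∈ ω → ¬ 1 ≤ M i ω) → (∀ ω ∈ E, ¬ (ω ∈ U ∧ ω ∈ Xi)) →
      (prodBernoulli w).real E * t ≤ (prodBernoulli w).real EB →
      (prodBernoulli w).real (L ∩ E) ≤ (prodBernoulli w).real (R ∩ E) := by
    intro E EB hE hEB hEBsub hE0 hEU hEt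
    -- the minority event: all effectively attached branches light, some branch attached
    have hsubL : (L ∩ E) ∩ G ⊆ (E ∩ ⋂ l ∈ T, NF l) \ (E ∩ ⋂ l ∈ T, (Y l)ᶜ) := by
      rintro ω ⟨⟨⟨h1, hj⟩, hωE⟩, hωG⟩
      refine ⟨⟨hωE, mem_biInter fun l _ hopen => le_trans (hMleN ω hωG l hopen) hj⟩, fun hall => ?_⟩
      obtain ⟨l, hl, h1l⟩ := (hNpos ω hωG).1 h1
      have hli : l ≠ i := by
        rintro rfl
        exact hE0 ω hωE hl h1l
      exact (mem_iInter₂.1 hall.2) l (Finset.mem_erase.2 ⟨hli, Finset.mem_univ _⟩) ⟨hl, h1l⟩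
    -- the target event: witness light in its branch, some branch attached
    have hsubR : (EB \ (EB ∩ ⋂ l ∈ T, (Y l)ᶜ)) ∩ G ⊆ R ∩ E := by
      rintro ω ⟨⟨hωEB, hnot⟩, hωG⟩
      obtain ⟨hωE, hBω⟩ := hEBsub hωEB
      have h1 : 1 ≤ N ω := by
        have hnot' : ω ∉ ⋂ l ∈ T, (Y l)ᶜ := fun h => hnot ⟨hωEB, h⟩
        simp only [mem_iInter, not_forall, mem_compl_iff, not_not] at hnot'
        obtain ⟨l, -, hl⟩ := hnot'
        exact (hNpos ω hωG).2 ⟨l, hl.1, hl.2⟩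
      refine ⟨⟨h1, ?_⟩, hωE⟩
      rw [hLcLb ω hωG (hEU ω hωE)]
      exact hBω
    calc (prodBernoulli w).real (L ∩ E)
        = (prodBernoulli w).real ((L ∩ E) ∩ G) := (measureReal_inter_support w _).symm
      _ ≤ (prodBernoulli w).real ((E ∩ ⋂ l ∈ T, NF l) \ (E ∩ ⋂ l ∈ T, (Y l)ᶜ)) :=
          measureReal_mono hsubL (measure_ne_top _ _)
      _ = (prodBernoulli w).real E *
            (∏ l ∈ T, (1 - c l + c l * sl l) - ∏ l ∈ T, (1 - c' l)) := by
          rw [measureReal_prodEvents_sdiff w T S hSdisj NF (fun l => (Y l)ᶜ) hNF_det hYc_det hYcNF E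
            (hE.mono hsub_i), hNFval, hYcval]
      _ ≤ (prodBernoulli w).real E * (t * D) := mul_le_mul_of_nonneg_left htel measureReal_nonneg
      _ ≤ (prodBernoulli w).real EB * D := by
          rw [← mul_assoc]; exact mul_le_mul_of_nonneg_right hEt hD0
      _ = (prodBernoulli w).real (EB \ (EB ∩ ⋂ l ∈ T, (Y l)ᶜ)) := by
          rw [measureReal_attach w T S hSdisj (fun l => (Y l)ᶜ) hYc_det EB (hEB.mono hsub_i), hYcval]
      _ = (prodBernoulli w).real ((EB \ (EB ∩ ⋂ l ∈ T, (Y l)ᶜ)) ∩ G) :=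
          (measureReal_inter_support w _).symm
      _ ≤ (prodBernoulli w).real (R ∩ E) := measureReal_mono hsubR (measure_ne_top _ _)
  -- ### piece 1: off the port pair (`E = Xc`)
  have hP1 : (prodBernoulli w).real (L \ Xi) ≤ (prodBernoulli w).real (R \ Xi) := by
    have hdet : DeterminedBy Xc (↑(S i) : Set (Sym2 (Fin n))) :=
      (determinedBy_closed (s(o, p i))).mono (by
        rw [Finset.coe_singleton, singleton_subset_iff, Finset.mem_coe]
        exact Finset.mem_insert_self _ _)
    have hdetB : DeterminedBy (Xc ∩ Bt) (↑(S i) : Set (Sym2 (Fin n))) :=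
      determinedBy_insert_restrict (V i) s(o, p i)
        (fun P ξ => ¬ P ∧ (A.filter fun x => (openGraph ξ).Reachable (a i) x).card ≤ j)
    have hXcBt : (prodBernoulli w).real (Xc ∩ Bt) = (1 - c i) * t :=
      measureReal_closed_inter_restrict w (V i) s(o, p i) (portEdge_not_mem_sym2 o V p hoV i)
        (fun ξ => (A.filter fun x => (openGraph ξ).Reachable (a i) x).card ≤ j)
    have h := hpiece Xc (Xc ∩ Bt) hdet hdetB subset_rfl (fun ω hω h => absurd h hω)
      (fun ω hω h => hω h.2) (by rw [hXcBt, measureReal_closed w s(o, p i)])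
    have e1 : L \ Xi = L ∩ Xc := Set.ext fun ω => Iff.rfl
    have e2 : R \ Xi = R ∩ Xc := Set.ext fun ω => Iff.rfl
    rw [e1, e2]
    exact h
  -- ### piece 2: port open, empty branch cluster (`E = Xi ∩ Z`)
  have hP2 : (prodBernoulli w).real (((L ∩ Xi) \ U) ∩ Z) ≤
      (prodBernoulli w).real (((R ∩ Xi) \ U) ∩ Z) := by
    have hdet : DeterminedBy (Xi ∩ Z) (↑(S i) : Set (Sym2 (Fin n))) :=
      determinedBy_insert_restrict (V i) s(o, p i)
        (fun P ξ => P ∧ ¬ 1 ≤ (A.filter fun x => (openGraph ξ).Reachable (p i) x).card)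
    have hdetB : DeterminedBy (Xi ∩ (Z ∩ Bt)) (↑(S i) : Set (Sym2 (Fin n))) :=
      determinedBy_insert_restrict (V i) s(o, p i)
        (fun P ξ => P ∧ (¬ 1 ≤ (A.filter fun x => (openGraph ξ).Reachable (p i) x).card ∧
          (A.filter fun x => (openGraph ξ).Reachable (a i) x).card ≤ j))
    have hXiZ : (prodBernoulli w).real (Xi ∩ Z) = c i * (prodBernoulli w).real Z :=
      measureReal_open_inter_restrict w (V i) s(o, p i) (portEdge_not_mem_sym2 o V p hoV i)
        (fun ξ => ¬ 1 ≤ (A.filter fun x => (openGraph ξ).Reachable (p i) x).card)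
    have hXiZB : (prodBernoulli w).real (Xi ∩ (Z ∩ Bt)) = c i * (prodBernoulli w).real (Z ∩ Bt) :=
      measureReal_open_inter_restrict w (V i) s(o, p i) (portEdge_not_mem_sym2 o V p hoV i)
        (fun ξ => ¬ 1 ≤ (A.filter fun x => (openGraph ξ).Reachable (p i) x).card ∧
          (A.filter fun x => (openGraph ξ).Reachable (a i) x).card ≤ j)
    have hHarris : (prodBernoulli w).real Z * t ≤ (prodBernoulli w).real (Z ∩ Bt) :=
      prodBernoulli_harris_lower w hZlow (hLblow i) MeasurableSet.of_discrete MeasurableSet.of_discrete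
    have hEt : (prodBernoulli w).real (Xi ∩ Z) * t ≤ (prodBernoulli w).real (Xi ∩ (Z ∩ Bt)) := by
      rw [hXiZ, hXiZB, mul_assoc]
      exact mul_le_mul_of_nonneg_left hHarris (hc0 i)
    have h := hpiece (Xi ∩ Z) (Xi ∩ (Z ∩ Bt)) hdet hdetB
      (fun ω hω => ⟨⟨hω.1, hω.2.1⟩, hω.2.2⟩) (fun ω hω _ => hω.2) (fun ω hω h => hZU ω hω.2 h.1) hEt
    have e1 : ((L ∩ Xi) \ U) ∩ Z = L ∩ (Xi ∩ Z) := by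
      ext ω
      simp only [mem_inter_iff, mem_sdiff]
      constructor
      · rintro ⟨⟨⟨hL', hX⟩, -⟩, hZ'⟩; exact ⟨hL', hX, hZ'⟩
      · rintro ⟨hL', hX, hZ'⟩; exact ⟨⟨⟨hL', hX⟩, hZU ω hZ'⟩, hZ'⟩
    have e2 : ((R ∩ Xi) \ U) ∩ Z = R ∩ (Xi ∩ Z) := by
      ext ω
      simp only [mem_inter_iff, mem_sdiff]
      constructor
      · rintro ⟨⟨⟨hR', hX⟩, -⟩, hZ'⟩; exact ⟨hR', hX, hZ'⟩
      · rintro ⟨hR', hX, hZ'⟩; exact ⟨⟨⟨hR', hX⟩, hZU ω hZ'⟩, hZ'⟩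
    rw [e1, e2]
    exact h
  -- ### piece 3: port open, witness off the port's branch cluster, nonempty branch cluster
  have hP3 : (prodBernoulli w).real (((L ∩ Xi) \ U) \ Z) ≤
      (prodBernoulli w).real (((R ∩ Xi) \ U) \ Z) := by
    set EL := {ω : BondConfig (Fin n) | ω ∉ U ∧ (1 ≤ M i ω ∧ M i ω ≤ j)} with hEL
    set ER := {ω : BondConfig (Fin n) | ω ∉ U ∧ (1 ≤ M i ω ∧ Lb i ω ≤ j)} with hER
    have hsubL : (((L ∩ Xi) \ U) \ Z) ∩ G ⊆ Xi ∩ EL := by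
      rintro ω ⟨⟨⟨⟨hωL, hXω⟩, hUω⟩, hZω⟩, hωG⟩
      have h1 : 1 ≤ M i ω := not_not.1 hZω
      exact ⟨hXω, hUω, h1, le_trans (hMleN ω hωG i hXω) hωL.2⟩
    have hsubR : (Xi ∩ ER) ∩ G ⊆ ((R ∩ Xi) \ U) \ Z := by
      rintro ω ⟨⟨hXω, hUω, h1, hB⟩, hωG⟩
      refine ⟨⟨⟨⟨le_trans h1 (hMleN ω hωG i hXω), ?_⟩, hXω⟩, hUω⟩, fun h => h h1⟩
      rw [hLcLb ω hωG fun h => hUω h.1]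
      exact hB
    have hXiEL : (prodBernoulli w).real (Xi ∩ EL) = c i * (prodBernoulli w).real EL :=
      measureReal_open_inter_restrict w (V i) s(o, p i) (portEdge_not_mem_sym2 o V p hoV i)
        (fun ξ => ¬ (openGraph ξ).Reachable (a i) (p i) ∧
          (1 ≤ (A.filter fun x => (openGraph ξ).Reachable (p i) x).card ∧
            (A.filter fun x => (openGraph ξ).Reachable (p i) x).card ≤ j))
    have hXiER : (prodBernoulli w).real (Xi ∩ ER) = c i * (prodBernoulli w).real ER :=
      measureReal_open_inter_restrict w (V i) s(o, p i) (portEdge_not_mem_sym2 o V p hoV i)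
        (fun ξ => ¬ (openGraph ξ).Reachable (a i) (p i) ∧
          (1 ≤ (A.filter fun x => (openGraph ξ).Reachable (p i) x).card ∧
            (A.filter fun x => (openGraph ξ).Reachable (a i) x).card ≤ j))
    have hELER : (prodBernoulli w).real EL ≤ (prodBernoulli w).real ER := by
      have hTi := hT i hi
      have hsplitL := measureReal_inter_add_sdiff (μ := prodBernoulli w)
        (s := {ω : BondConfig (Fin n) | 1 ≤ M i ω ∧ M i ω ≤ j}) (MeasurableSet.of_discrete (s := U))
        (measure_ne_top _ _)
      have hsplitR := measureReal_inter_add_sdiff (μ := prodBernoulli w)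
        (s := {ω : BondConfig (Fin n) | 1 ≤ M i ω ∧ Lb i ω ≤ j}) (MeasurableSet.of_discrete (s := U))
        (measure_ne_top _ _)
      have heqU : ({ω : BondConfig (Fin n) | 1 ≤ M i ω ∧ M i ω ≤ j} ∩ U) =
          ({ω : BondConfig (Fin n) | 1 ≤ M i ω ∧ Lb i ω ≤ j} ∩ U) := by
        ext ω
        simp only [mem_inter_iff, mem_setOf_eq]
        constructor
        · rintro ⟨⟨h1, hj⟩, hU⟩; exact ⟨⟨h1, (hUM ω hU).1 ▸ hj⟩, hU⟩
        · rintro ⟨⟨h1, hj⟩, hU⟩; exact ⟨⟨h1, (hUM ω hU).1.symm ▸ hj⟩, hU⟩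
      have hdL : ({ω : BondConfig (Fin n) | 1 ≤ M i ω ∧ M i ω ≤ j} \ U) = EL := by
        ext ω; simp only [mem_sdiff, mem_setOf_eq, hEL]; tauto
      have hdR : ({ω : BondConfig (Fin n) | 1 ≤ M i ω ∧ Lb i ω ≤ j} \ U) = ER := by
        ext ω; simp only [mem_sdiff, mem_setOf_eq, hER]; tauto
      rw [heqU, hdL] at hsplitL
      rw [hdR] at hsplitR
      linarith
    calc (prodBernoulli w).real (((L ∩ Xi) \ U) \ Z)
        = (prodBernoulli w).real ((((L ∩ Xi) \ U) \ Z) ∩ G) := (measureReal_inter_support w _).symm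
      _ ≤ (prodBernoulli w).real (Xi ∩ EL) := measureReal_mono hsubL (measure_ne_top _ _)
      _ = c i * (prodBernoulli w).real EL := hXiEL
      _ ≤ c i * (prodBernoulli w).real ER := mul_le_mul_of_nonneg_left hELER (hc0 i)
      _ = (prodBernoulli w).real (Xi ∩ ER) := hXiER.symm
      _ = (prodBernoulli w).real ((Xi ∩ ER) ∩ G) := (measureReal_inter_support w _).symm
      _ ≤ (prodBernoulli w).real (((R ∩ Xi) \ U) \ Z) := measureReal_mono hsubR (measure_ne_top _ _)
  -- ### piece 0: port open and witness joined to the port — the two clusters coincide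
  have hP0 : (prodBernoulli w).real ((L ∩ Xi) ∩ U) ≤ (prodBernoulli w).real ((R ∩ Xi) ∩ U) := by
    refine measureReal_mono (fun ω hω => ?_) (measure_ne_top _ _)
    obtain ⟨⟨⟨h1, hj⟩, hXω⟩, hUω⟩ := hω
    refine ⟨⟨⟨h1, ?_⟩, hXω⟩, hUω⟩
    rw [hLcN ω hUω hXω]
    exact hj
  -- ### assemble
  have hL1 := measureReal_inter_add_sdiff (μ := prodBernoulli w) (s := L)
    (MeasurableSet.of_discrete (s := Xi)) (measure_ne_top _ _)
  have hR1 := measureReal_inter_add_sdiff (μ := prodBernoulli w) (s := R)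
    (MeasurableSet.of_discrete (s := Xi)) (measure_ne_top _ _)
  have hL2 := measureReal_inter_add_sdiff (μ := prodBernoulli w) (s := L ∩ Xi)
    (MeasurableSet.of_discrete (s := U)) (measure_ne_top _ _)
  have hR2 := measureReal_inter_add_sdiff (μ := prodBernoulli w) (s := R ∩ Xi)
    (MeasurableSet.of_discrete (s := U)) (measure_ne_top _ _)
  have hL3 := measureReal_inter_add_sdiff (μ := prodBernoulli w) (s := (L ∩ Xi) \ U)
    (MeasurableSet.of_discrete (s := Z)) (measure_ne_top _ _)
  have hR3 := measureReal_inter_add_sdiff (μ := prodBernoulli w) (s := (R ∩ Xi) \ U)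
    (MeasurableSet.of_discrete (s := Z)) (measure_ne_top _ _)
  linarith

end SteinerPorts

end CutObserver

end Summit.CriticalPhenomena.PercolationContinuityZ3.Theorems

end
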